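import Mathlib
import HarnessLib
import Summits.AtomisticToContinuum.FouriersLaw.Theorems.JunctionLocalityConductanceLowerBoundStubShortTimeDipoleFloorAux7
import Summits.AtomisticToContinuum.FouriersLaw.Theorems.JunctionLocalityConductanceLowerBoundStubShortTimeDipoleFloorAux11
import Summits.AtomisticToContinuum.FouriersLaw.Theorems.JunctionLocalityConductanceLowerBoundStubShortTimeDipoleFloorAux12
import Literature.MathematicalPhysics.KineticTheory.LangevinChainExpMartingale
import Mathlib.MeasureTheory.Integral.MeanInequalities

/-!
# Short-time dipole floor, helper 13: the annealed local light cone at one far bond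

Helper (`--supports stmt-AtomisticToContinuum-11749`) for stub `stub_shortTimeDipoleFloor` (S) of line
`kick-dipole-no-collapse`, crux `JunctionLocality.ConductanceLowerBound`.

For the pinned anharmonic chain (both baths at `T`), the stationary law `π = μ_T ⊗ W`, the contact power
`a₀ = p_0 ∂_{q_0}H` and a genuine bond `(k, k+1)` with `k ≥ 1`, the synchronous coupling of the flows from `x` and from `x^0`
(momentum of the contact site flipped) satisfies, for `s ∈ [0, 1]` with `1440 e C₁ A₁ s ≤ 1`,

  `∫⁻ |a₀(x)| · |j_k(Φ_s x^0) − j_k(Φ_s x)| dπ ≤ 4 √K_G √(15C) · (1440 e C₁ A₁ s)^k`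

(`lintegral_contactPower_mul_flipDiff_le`): pathwise, helper 10 (one-scalar domination of `δj_k`) times helper 7 (the local
light cone `u_k + u_{k+1} ≤ 4|p_0| Σ_{n ≥ k} (s^n/n!) 3^n S_n`); then the series is integrated term by term, each term by
Cauchy–Schwarz with the `N`-uniform second moments of the prefactor (helper 11, `K_G = 4c_j²c_a²K`) and of the local sums `S_n`
(helper 12, factorial growth), and `n^n/n! ≤ e^n`, `(n+1)² ≤ 4^n` turn the result into a geometric series.  The constant is
uniform in `N` and decays geometrically in the distance `k` of the bond from the contact.  All tactic work is done in abstract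
lemmas over an arbitrary measure space; the concrete statement only instantiates them.
-/

noncomputable section

open MeasureTheory ProbabilityTheory Set Filter Topology Finset
open scoped NNReal ENNReal

namespace Summit.AtomisticToContinuum.FouriersLaw.Cruxes.ConductanceLowerBound.KickDipoleNoCollapse

open Literature.MathematicalPhysics.KineticTheory Literature.MathematicalPhysics.KineticTheory.HeatConduction
open Literature.Probability.Process OscillatorChain
open Summit.AtomisticToContinuum.FouriersLaw.Theorems
open Summit.AtomisticToContinuum.FouriersLaw.Theorems.NonBallistic

/-! ### Elementary tools -/

/-- **Cauchy–Schwarz with real bounds**: `∫⁻ f g ≤ √A √B` when `∫⁻ f² ≤ A` and `∫⁻ g² ≤ B`. -/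
theorem lintegral_mul_le_sqrt_mul_sqrt {α : Type*} [MeasurableSpace α] (π : Measure α) {f g : α → ℝ≥0∞}
    (hf : AEMeasurable f π) (hg : AEMeasurable g π) {A B : ℝ} (hA : 0 ≤ A) (hB : 0 ≤ B)
    (hfA : ∫⁻ a, f a ^ 2 ∂π ≤ ENNReal.ofReal A) (hgB : ∫⁻ a, g a ^ 2 ∂π ≤ ENNReal.ofReal B) :
    ∫⁻ a, f a * g a ∂π ≤ ENNReal.ofReal (Real.sqrt A * Real.sqrt B) := by
  have key := ENNReal.lintegral_mul_le_Lp_mul_Lq π Real.HolderConjugate.two_two hf hg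
  have hf2 : ∫⁻ a, f a ^ (2 : ℝ) ∂π = ∫⁻ a, f a ^ 2 ∂π := by
    refine lintegral_congr fun a => ?_
    rw [← ENNReal.rpow_natCast]; norm_num
  have hg2 : ∫⁻ a, g a ^ (2 : ℝ) ∂π = ∫⁻ a, g a ^ 2 ∂π := by
    refine lintegral_congr fun a => ?_
    rw [← ENNReal.rpow_natCast]; norm_num
  calc ∫⁻ a, f a * g a ∂π = ∫⁻ a, (f * g) a ∂π := rfl
    _ ≤ (∫⁻ a, f a ^ (2 : ℝ) ∂π) ^ (1 / (2 : ℝ)) * (∫⁻ a, g a ^ (2 : ℝ) ∂π) ^ (1 / (2 : ℝ)) := key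
    _ ≤ ENNReal.ofReal A ^ (1 / (2 : ℝ)) * ENNReal.ofReal B ^ (1 / (2 : ℝ)) := by
        rw [hf2, hg2]
        exact mul_le_mul' (ENNReal.rpow_le_rpow hfA (by norm_num)) (ENNReal.rpow_le_rpow hgB (by norm_num))
    _ = ENNReal.ofReal (Real.sqrt A * Real.sqrt B) := by
        rw [ENNReal.ofReal_rpow_of_nonneg hA (by norm_num), ENNReal.ofReal_rpow_of_nonneg hB (by norm_num),
          ← ENNReal.ofReal_mul (by positivity), Real.sqrt_eq_rpow, Real.sqrt_eq_rpow]

/-- `n^n / n! ≤ e^n`. -/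
theorem pow_self_div_factorial_le (n : ℕ) : (n : ℝ) ^ n / n.factorial ≤ Real.exp 1 ^ n := by
  have h := Real.pow_div_factorial_le_exp (n : ℝ) (Nat.cast_nonneg n) n
  rwa [← Real.exp_one_pow] at h

/-- `(n + 1)² ≤ 4^n`. -/
theorem succ_sq_le_four_pow (n : ℕ) : ((n : ℝ) + 1) ^ 2 ≤ 4 ^ n := by
  induction n with
  | zero => norm_num
  | succ m ih =>
    have h4 : (1 : ℝ) ≤ 4 ^ m := one_le_pow₀ (by norm_num)
    have hm0 : (0 : ℝ) ≤ m := Nat.cast_nonneg m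
    have h5 : (m : ℝ) + 1 ≤ 4 ^ m := le_trans (by nlinarith) ih
    push_cast
    rw [pow_succ (4:ℝ) m]
    nlinarith

/-- A geometric comparison: for `0 ≤ ρ ≤ 1/2` and `k ≤ n`, `ρ^n ≤ (2ρ)^k (1/2)^n`. -/
theorem pow_le_two_mul_pow_mul_half_pow {ρ : ℝ} (hρ0 : 0 ≤ ρ) (hρ : ρ ≤ 1 / 2) {k n : ℕ} (hkn : k ≤ n) :
    ρ ^ n ≤ (2 * ρ) ^ k * (1 / 2) ^ n := by
  obtain ⟨m, rfl⟩ : ∃ m, n = k + m := ⟨n - k, by omega⟩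
  have e : (2 * ρ) ^ k * ((1 / 2 : ℝ) ^ k * (1 / 2) ^ m) = ρ ^ k * (1 / 2) ^ m := by
    calc (2 * ρ) ^ k * ((1 / 2 : ℝ) ^ k * (1 / 2) ^ m) = ((2 * ρ) * (1 / 2)) ^ k * (1 / 2) ^ m := by
          rw [mul_pow (2 * ρ) (1 / 2) k]; ring
      _ = ρ ^ k * (1 / 2) ^ m := by
          congr 2
          ring
  rw [pow_add, pow_add, e]
  exact mul_le_mul_of_nonneg_left (pow_le_pow_left₀ hρ0 hρ m) (pow_nonneg hρ0 _)

/-- The real bookkeeping of one term of the annealed series: with `Y_n = (n+1)² (60 C₁ A₁ n)^n`,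
`(s^n/n!) 3^n Y_n ≤ (720 e C₁ A₁ s)^n` (`(n+1)² ≤ 4^n`, `n^n/n! ≤ e^n`). -/
theorem seriesTerm_le {C₁ A₁ s : ℝ} (hC₁ : 0 ≤ C₁) (hA₁ : 0 ≤ A₁) (hs0 : 0 ≤ s) (n : ℕ) :
    s ^ n / n.factorial * 3 ^ n * (((n : ℝ) + 1) ^ 2 * (60 * C₁ * A₁ * n) ^ n) ≤
      (720 * Real.exp 1 * C₁ * A₁ * s) ^ n := by
  have hfac : (n.factorial : ℝ) ≠ 0 := by exact_mod_cast Nat.factorial_ne_zero n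
  have e : s ^ n / n.factorial * 3 ^ n * (((n : ℝ) + 1) ^ 2 * (60 * C₁ * A₁ * n) ^ n) =
      ((n : ℝ) + 1) ^ 2 * (180 * C₁ * A₁ * s) ^ n * ((n : ℝ) ^ n / n.factorial) := by
    rw [mul_pow, mul_pow, mul_pow, mul_pow, mul_pow, mul_pow, show (180 : ℝ) ^ n = 3 ^ n * 60 ^ n by rw [← mul_pow]; norm_num]
    field_simp
  rw [e]
  have h1 := succ_sq_le_four_pow n
  have h2 := pow_self_div_factorial_le n
  have h3 : 0 ≤ (180 * C₁ * A₁ * s) ^ n := by positivity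
  have h4 : 0 ≤ (n : ℝ) ^ n / n.factorial := by positivity
  calc ((n : ℝ) + 1) ^ 2 * (180 * C₁ * A₁ * s) ^ n * ((n : ℝ) ^ n / n.factorial)
      ≤ 4 ^ n * (180 * C₁ * A₁ * s) ^ n * Real.exp 1 ^ n :=
        mul_le_mul (mul_le_mul_of_nonneg_right h1 h3) h2 h4 (by positivity)
    _ = (720 * Real.exp 1 * C₁ * A₁ * s) ^ n := by rw [← mul_pow, ← mul_pow]; ring_nf

/-- The real bookkeeping of one term, completed: with `a_n = (s^n/n!) 3^n`, `M_n = 15 C Y_n²`, `ρ = 720 e C₁ A₁ s ≤ 1/2`,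
`B₀ = 2 √K_G √(15C)` and `k ≤ n`: `2 a_n √K_G √M_n ≤ (2ρ)^k B₀ (1/2)^n`. -/
theorem annealedTerm_le {C C₁ A₁ KG s : ℝ} (hC : 0 ≤ C) (hC₁ : 0 ≤ C₁) (hA₁ : 0 ≤ A₁) (hs0 : 0 ≤ s)
    (hρ : 720 * Real.exp 1 * C₁ * A₁ * s ≤ 1 / 2) {k n : ℕ} (hkn : k ≤ n) :
    2 * (s ^ n / n.factorial * 3 ^ n) *
        (Real.sqrt KG * Real.sqrt (15 * C * ((((n : ℝ) + 1) ^ 2 * (60 * C₁ * A₁ * n) ^ n) ^ 2))) ≤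
      (2 * (720 * Real.exp 1 * C₁ * A₁ * s)) ^ k * (2 * Real.sqrt KG * Real.sqrt (15 * C)) * (1 / 2) ^ n := by
  set ρ : ℝ := 720 * Real.exp 1 * C₁ * A₁ * s with hρdef
  set Y : ℝ := ((n : ℝ) + 1) ^ 2 * (60 * C₁ * A₁ * n) ^ n with hY
  have hρ0 : 0 ≤ ρ := by positivity
  have hY0 : 0 ≤ Y := by positivity
  have hsqrt : Real.sqrt (15 * C * Y ^ 2) = Real.sqrt (15 * C) * Y := by
    rw [Real.sqrt_mul (by positivity), Real.sqrt_sq hY0]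
  rw [hsqrt]
  have h1 : s ^ n / n.factorial * 3 ^ n * Y ≤ ρ ^ n := seriesTerm_le hC₁ hA₁ hs0 n
  have h2 : ρ ^ n ≤ (2 * ρ) ^ k * (1 / 2) ^ n := pow_le_two_mul_pow_mul_half_pow hρ0 hρ hkn
  have hB : 0 ≤ 2 * Real.sqrt KG * Real.sqrt (15 * C) := by positivity
  calc 2 * (s ^ n / n.factorial * 3 ^ n) * (Real.sqrt KG * (Real.sqrt (15 * C) * Y))
      = (2 * Real.sqrt KG * Real.sqrt (15 * C)) * (s ^ n / n.factorial * 3 ^ n * Y) := by ring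
    _ ≤ (2 * Real.sqrt KG * Real.sqrt (15 * C)) * ((2 * ρ) ^ k * (1 / 2) ^ n) :=
        mul_le_mul_of_nonneg_left (h1.trans h2) hB
    _ = (2 * ρ) ^ k * (2 * Real.sqrt KG * Real.sqrt (15 * C)) * (1 / 2) ^ n := by ring

/-- **Pathwise bookkeeping at a far bond** (pure real inequalities): the one-scalar domination of `δj_k` and the two light-cone
deviations `u_k ≤ 2|p| L_k`, `u_{k+1} ≤ 2|p| L_{k+1} ≤ 2|p| L_k` give `|a| |δj_k| ≤ G · 2L_k`, `G = c_j |a| 2|p| E² E'²`. -/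
theorem farBond_pathwise_abstract {A Δ cj E E' dq dp dq' dp' p Lk Lk1 : ℝ} (hA : 0 ≤ A) (hcj : 0 ≤ cj) (hp : 0 ≤ p)
    (hΔ : Δ ≤ cj * E ^ 2 * E' ^ 2 * (dq + dp + dq' + dp')) (hu : dq + dp ≤ 2 * p * Lk)
    (hu' : dq' + dp' ≤ 2 * p * Lk1) (hL : Lk1 ≤ Lk) :
    A * Δ ≤ cj * A * (2 * p) * E ^ 2 * E' ^ 2 * (2 * Lk) := by
  have h3 : 2 * p * Lk1 ≤ 2 * p * Lk := mul_le_mul_of_nonneg_left hL (by positivity)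
  have hD : dq + dp + dq' + dp' ≤ 2 * p * Lk + 2 * p * Lk := by linarith
  have hpre : 0 ≤ cj * E ^ 2 * E' ^ 2 := by positivity
  calc A * Δ ≤ A * (cj * E ^ 2 * E' ^ 2 * (2 * p * Lk + 2 * p * Lk)) :=
        mul_le_mul_of_nonneg_left (hΔ.trans (mul_le_mul_of_nonneg_left hD hpre)) hA
    _ = cj * A * (2 * p) * E ^ 2 * E' ^ 2 * (2 * Lk) := by ring

/-- **The annealed series, abstract core.**  On any measure space: a nonnegative measurable prefactor `G` with
`∫⁻ G² ≤ K_G`, nonnegative measurable random coefficients `S_n` with `∫⁻ S_n² ≤ M_n` (`n ≥ k`), nonnegative real weights `a_n`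
with the pointwise summability of `Σ_{n ≥ k} a_n S_n`, and the real bookkeeping `2 a_n √K_G √M_n ≤ (2ρ)^k B₀ 2^{−n}` give
`∫⁻ G · 2 Σ_{n ≥ k} a_n S_n ≤ 2 B₀ (2ρ)^k` (term-by-term integration, Cauchy–Schwarz, geometric series). -/
theorem lintegral_annealedSeries_le {Ω : Type*} [MeasurableSpace Ω] (π : Measure Ω) {G : Ω → ℝ} {S : ℕ → Ω → ℝ}
    {a M : ℕ → ℝ} {KG B₀ ρ : ℝ} {k : ℕ}
    (hGm : Measurable G) (hSm : ∀ n, Measurable (S n)) (hG0 : ∀ q, 0 ≤ G q) (hS0 : ∀ n q, 0 ≤ S n q)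
    (ha0 : ∀ n, 0 ≤ a n) (hKG0 : 0 ≤ KG) (hM0 : ∀ n, 0 ≤ M n) (hB₀0 : 0 ≤ B₀) (hρ0 : 0 ≤ ρ)
    (hsum : ∀ q, Summable fun n : ℕ => if k ≤ n then a n * S n q else 0)
    (hGsq : ∫⁻ q, ENNReal.ofReal (G q) ^ 2 ∂π ≤ ENNReal.ofReal KG)
    (hSsq : ∀ n, k ≤ n → ∫⁻ q, ENNReal.ofReal (S n q) ^ 2 ∂π ≤ ENNReal.ofReal (M n))
    (hreal : ∀ n, k ≤ n → 2 * a n * (Real.sqrt KG * Real.sqrt (M n)) ≤ (2 * ρ) ^ k * B₀ * (1 / 2) ^ n) :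
    ∫⁻ q, ENNReal.ofReal (G q * (2 * ∑' n : ℕ, if k ≤ n then a n * S n q else 0)) ∂π ≤
      ENNReal.ofReal (2 * B₀ * (2 * ρ) ^ k) := by
  -- one term of the series
  have hterm : ∀ n : ℕ, ∫⁻ q, ENNReal.ofReal (2 * G q * (if k ≤ n then a n * S n q else 0)) ∂π ≤
      ENNReal.ofReal ((2 * ρ) ^ k * B₀ * (1 / 2) ^ n) := by
    intro n
    by_cases hkn : k ≤ n
    · have e : ∀ q, ENNReal.ofReal (2 * G q * (if k ≤ n then a n * S n q else 0)) =
          ENNReal.ofReal (2 * a n) * (ENNReal.ofReal (G q) * ENNReal.ofReal (S n q)) := by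
        intro q
        rw [if_pos hkn, show 2 * G q * (a n * S n q) = 2 * a n * (G q * S n q) by ring,
          ENNReal.ofReal_mul (by have := ha0 n; positivity), ENNReal.ofReal_mul (hG0 q)]
      have hCS := lintegral_mul_le_sqrt_mul_sqrt π (hGm.ennreal_ofReal).aemeasurable
        ((hSm n).ennreal_ofReal).aemeasurable hKG0 (hM0 n) hGsq (hSsq n hkn)
      calc ∫⁻ q, ENNReal.ofReal (2 * G q * (if k ≤ n then a n * S n q else 0)) ∂π
          = ENNReal.ofReal (2 * a n) * ∫⁻ q, ENNReal.ofReal (G q) * ENNReal.ofReal (S n q) ∂π := by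
            have hm : Measurable fun q => ENNReal.ofReal (G q) * ENNReal.ofReal (S n q) :=
              hGm.ennreal_ofReal.mul (hSm n).ennreal_ofReal
            rw [lintegral_congr e, lintegral_const_mul _ hm]
        _ ≤ ENNReal.ofReal (2 * a n) * ENNReal.ofReal (Real.sqrt KG * Real.sqrt (M n)) := mul_le_mul' le_rfl hCS
        _ = ENNReal.ofReal (2 * a n * (Real.sqrt KG * Real.sqrt (M n))) :=
            (ENNReal.ofReal_mul (by have := ha0 n; positivity)).symm
        _ ≤ ENNReal.ofReal ((2 * ρ) ^ k * B₀ * (1 / 2) ^ n) := ENNReal.ofReal_le_ofReal (hreal n hkn)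
    · have e : ∀ q, ENNReal.ofReal (2 * G q * (if k ≤ n then a n * S n q else 0)) = 0 := fun q => by
        rw [if_neg hkn, mul_zero, ENNReal.ofReal_zero]
      rw [lintegral_congr e, lintegral_zero]
      exact bot_le
  -- sum the series
  have hsum2 : Summable (fun n : ℕ => (2 * ρ) ^ k * B₀ * (1 / 2 : ℝ) ^ n) := summable_geometric_two.mul_left _
  calc ∫⁻ q, ENNReal.ofReal (G q * (2 * ∑' n : ℕ, if k ≤ n then a n * S n q else 0)) ∂π
      = ∫⁻ q, ∑' n : ℕ, ENNReal.ofReal (2 * G q * (if k ≤ n then a n * S n q else 0)) ∂π := by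
        refine lintegral_congr fun q => ?_
        have hnn : ∀ n, 0 ≤ 2 * G q * (if k ≤ n then a n * S n q else 0) := fun n =>
          mul_nonneg (mul_nonneg zero_le_two (hG0 q)) (by split_ifs <;> [exact mul_nonneg (ha0 n) (hS0 n q); exact le_rfl])
        rw [show G q * (2 * ∑' n : ℕ, if k ≤ n then a n * S n q else 0) =
            (2 * G q) * ∑' n : ℕ, (if k ≤ n then a n * S n q else 0) by ring, ← tsum_mul_left,
          ENNReal.ofReal_tsum_of_nonneg hnn ((hsum q).mul_left _)]
    _ = ∑' n : ℕ, ∫⁻ q, ENNReal.ofReal (2 * G q * (if k ≤ n then a n * S n q else 0)) ∂π := by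
        refine lintegral_tsum fun n => ?_
        refine (Measurable.ennreal_ofReal ?_).aemeasurable
        refine (hGm.const_mul 2).mul ?_
        split_ifs <;> [exact (hSm n).const_mul (a n); exact measurable_const]
    _ ≤ ∑' n : ℕ, ENNReal.ofReal ((2 * ρ) ^ k * B₀ * (1 / 2) ^ n) := ENNReal.tsum_le_tsum hterm
    _ = ENNReal.ofReal (∑' n : ℕ, (2 * ρ) ^ k * B₀ * (1 / 2) ^ n) :=
        (ENNReal.ofReal_tsum_of_nonneg (fun n => by positivity) hsum2).symm
    _ = ENNReal.ofReal (2 * B₀ * (2 * ρ) ^ k) := by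
        congr 1
        rw [tsum_mul_left, tsum_geometric_two]
        ring

/-! ### The annealed light cone at one far bond -/

variable {ω₂ lam β γ : ℝ} (hω : 0 < ω₂) (hl : 0 ≤ lam) (hβ : 0 ≤ β) (hγ : 0 ≤ γ) {T : ℝ} (hT : 0 < T)

include hω hl hβ hγ hT in
/-- **The annealed local light cone at a far bond.**  For `N ≥ 2`, a genuine bond `(k, k+1)` with `k ≥ 1`, a time `s ∈ [0, 1]`
with `1440 e C₁ A₁ s ≤ 1` (`C₁ = 1 + 2γ + ω₂ + 2lam + 8(1+2β)` the local Lipschitz scale, `A₁ = max A 1` from the factorial Gibbs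
moments `∫ q^{2k}, ∫ p^{2k} ≤ C(Ak)^k`, `K` the bond-scalar moment bound of helper 11):
`∫⁻ |a₀(x)| |j_k(Φ_s(x^0,ω)) − j_k(Φ_s(x,ω))| d(μ_T ⊗ W) ≤ 4 √(4c_j²c_a²K) √(15C) (1440 e C₁ A₁ s)^k`. -/
theorem lintegral_contactPower_mul_flipDiff_le {K : ℝ}
    (hK : ∀ (N : ℕ) (k l : Fin N) (a : ℕ), a ≤ 16 →
      Integrable (fun z : PhaseSpace N => (1 + z.1 k ^ 2 + z.1 l ^ 2 + z.2 k ^ 2 + z.2 l ^ 2) ^ a) ((pinnedChain ω₂ lam β γ).gibbsMeasure N T) ∧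
      ∫ z, (1 + z.1 k ^ 2 + z.1 l ^ 2 + z.2 k ^ 2 + z.2 l ^ 2) ^ a ∂((pinnedChain ω₂ lam β γ).gibbsMeasure N T) ≤ K)
    {C A : ℝ} (hC1 : 1 ≤ C) (hA0 : 0 < A)
    (hmom : ∀ (N : ℕ) (i : Fin N) (k : ℕ),
      Integrable (fun x : PhaseSpace N => x.1 i ^ (2 * k)) ((pinnedChain ω₂ lam β γ).gibbsMeasure N T) ∧
      ∫ x, x.1 i ^ (2 * k) ∂((pinnedChain ω₂ lam β γ).gibbsMeasure N T) ≤ C * (A * k) ^ k ∧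
      Integrable (fun x : PhaseSpace N => x.2 i ^ (2 * k)) ((pinnedChain ω₂ lam β γ).gibbsMeasure N T) ∧
      ∫ x, x.2 i ^ (2 * k) ∂((pinnedChain ω₂ lam β γ).gibbsMeasure N T) ≤ C * (A * k) ^ k)
    {N : ℕ} (hN : 0 < N) (hN2 : 2 ≤ N) (k : Fin N) (hk : k.val + 1 < N) (hk1 : 1 ≤ k.val) {s : ℝ} (hs0 : 0 ≤ s)
    (hs1 : s ≤ 1) (hsρ : 1440 * Real.exp 1 * (1 + 2 * γ + (ω₂ + 2 * lam + 8 * (1 + 2 * β))) * max A 1 * s ≤ 1) :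
    ∫⁻ q, ENNReal.ofReal (|q.1.2 ⟨0, hN⟩ * partialQ ⟨0, hN⟩ ((pinnedChain ω₂ lam β γ).hamiltonian N) q.1| *
        |(pinnedChain ω₂ lam β γ).bondCurrent N k
            ((pinnedChain ω₂ lam β γ).solMap N T T s (momentumFlip ⟨0, hN⟩ q.1) (pairPath q.2)) -
          (pinnedChain ω₂ lam β γ).bondCurrent N k ((pinnedChain ω₂ lam β γ).solMap N T T s q.1 (pairPath q.2))|)
        ∂(((pinnedChain ω₂ lam β γ).gibbsMeasure N T).prod wienerPair) ≤
      ENNReal.ofReal (4 * Real.sqrt (4 * (7 + 15 * β) ^ 2 * (ω₂ + 2 * lam + 2 + 5 * β) ^ 2 * K) * Real.sqrt (15 * C) *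
        (1440 * Real.exp 1 * (1 + 2 * γ + (ω₂ + 2 * lam + 8 * (1 + 2 * β))) * max A 1 * s) ^ k.val) := by
  set P := pinnedChain ω₂ lam β γ with hP
  set μ := P.gibbsMeasure N T with hμ
  set π : Measure (PhaseSpace N × WienerPair) := μ.prod wienerPair with hπ
  set i0 : Fin N := ⟨0, hN⟩ with hi0
  set k1 : Fin N := ⟨k.val + 1, hk⟩ with hk1def
  set C₁ : ℝ := 1 + 2 * γ + (ω₂ + 2 * lam + 8 * (1 + 2 * β)) with hC₁
  set A₁ : ℝ := max A 1 with hA₁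
  set cj : ℝ := 7 + 15 * β with hcj
  set ca : ℝ := ω₂ + 2 * lam + 2 + 5 * β with hca
  set KG : ℝ := 4 * cj ^ 2 * ca ^ 2 * K with hKG
  set ρ : ℝ := 720 * Real.exp 1 * C₁ * A₁ * s with hρdef
  have hC₁0 : 0 ≤ C₁ := by positivity
  have hA₁0 : 0 ≤ A₁ := le_trans zero_le_one (le_max_right _ _)
  have hC0 : 0 ≤ C := zero_le_one.trans hC1
  have hcj0 : 0 ≤ cj := by positivity
  have hρ0 : 0 ≤ ρ := by positivity
  have hρhalf : ρ ≤ 1 / 2 := by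
    have : 2 * ρ = 1440 * Real.exp 1 * C₁ * A₁ * s := by rw [hρdef]; ring
    linarith
  haveI hμP : IsProbabilityMeasure μ := pinnedChain_isProbabilityMeasure_gibbsMeasure hω hl hβ γ N hT
  have hK0 : 0 ≤ K := by
    obtain ⟨-, hle⟩ := hK N k k1 0 (by norm_num)
    simp at hle
    linarith
  have hKG0 : 0 ≤ KG := by positivity
  -- the random objects
  set Φ : ℝ → PhaseSpace N → WienerPair → PhaseSpace N := fun r x ω => P.solMap N T T r x (pairPath ω) with hΦ
  set θ : Fin N → PhaseSpace N × WienerPair → ℝ := fun m q =>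
    1 + (2 * q.1.1 m ^ 2 + 2 * s * ∫ r in (0:ℝ)..s, (Φ r q.1 q.2).2 m ^ 2) +
      (2 * q.1.1 m ^ 2 + 2 * s * ∫ r in (0:ℝ)..s, (Φ r (momentumFlip i0 q.1) q.2).2 m ^ 2) with hθ
  set Θ : Fin N → PhaseSpace N × WienerPair → ℝ := fun l q =>
    ∑ m : Fin N, if m.val ≤ l.val + 1 ∧ l.val ≤ m.val + 1 then θ m q else 0 with hΘ
  set S : ℕ → PhaseSpace N × WienerPair → ℝ := fun n q => ∑ l : Fin N, if l.val ≤ n then (C₁ * Θ l q) ^ n else 0 with hS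
  set a : ℕ → ℝ := fun n => s ^ n / n.factorial * 3 ^ n with ha
  set L : Fin N → PhaseSpace N × WienerPair → ℝ := fun m q => ∑' n : ℕ, if m.val ≤ n then a n * S n q else 0 with hL
  set E : PhaseSpace N → ℝ := fun z => 1 + z.1 k ^ 2 + z.1 k1 ^ 2 + z.2 k ^ 2 + z.2 k1 ^ 2 with hE
  set G : PhaseSpace N × WienerPair → ℝ := fun q =>
    cj * |q.1.2 i0 * partialQ i0 (P.hamiltonian N) q.1| * (2 * |q.1.2 i0|) * E (Φ s q.1 q.2) ^ 2 *
      E (Φ s (momentumFlip i0 q.1) q.2) ^ 2 with hG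
  set M : ℕ → ℝ := fun n => 15 * C * ((((n : ℝ) + 1) ^ 2 * (60 * C₁ * A₁ * n) ^ n) ^ 2) with hM
  -- nonnegativity
  have hθ0 : ∀ m q, 0 ≤ θ m q := fun m q => zero_le_one.trans (one_le_siteWeight P N T i0 m hs0 q)
  have hΘ0 : ∀ l q, 0 ≤ Θ l q := fun l q => Finset.sum_nonneg fun m _ => by
    split_ifs <;> [exact hθ0 m q; exact le_rfl]
  have hS0 : ∀ n q, 0 ≤ S n q := fun n q => Finset.sum_nonneg fun l _ => by
    split_ifs <;> [exact pow_nonneg (mul_nonneg hC₁0 (hΘ0 l q)) n; exact le_rfl]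
  have ha0 : ∀ n, 0 ≤ a n := fun n => by positivity
  have hLsum : ∀ (m : Fin N) q, Summable (fun n : ℕ => if m.val ≤ n then a n * S n q else 0) := fun m q =>
    summable_lightConeSeries i0 (fun l => Θ l q) (fun l => hΘ0 l q) hC₁0 hs0 (fun l => l.val) m.val
  have hL0 : ∀ m q, 0 ≤ L m q := fun m q => tsum_nonneg fun n => by
    split_ifs <;> [exact mul_nonneg (ha0 n) (hS0 n q); exact le_rfl]
  have hE0 : ∀ z, 0 ≤ E z := fun z => by positivity
  have hG0 : ∀ q, 0 ≤ G q := fun q => by positivity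
  have hM0 : ∀ n, 0 ≤ M n := fun n => by positivity
  -- (F1) the pathwise bound
  have hF1 : ∀ q : PhaseSpace N × WienerPair,
      |q.1.2 i0 * partialQ i0 (P.hamiltonian N) q.1| *
        |P.bondCurrent N k (Φ s (momentumFlip i0 q.1) q.2) - P.bondCurrent N k (Φ s q.1 q.2)| ≤ G q * (2 * L k q) := by
    intro q
    have hj := abs_bondCurrent_sub_le_scalar (ω₂ := ω₂) (lam := lam) (γ := γ) hβ k hk (Φ s q.1 q.2)
      (Φ s (momentumFlip i0 q.1) q.2)
    have hu : ∀ m : Fin N, |(Φ s (momentumFlip i0 q.1) q.2).1 m - (Φ s q.1 q.2).1 m| +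
        |(Φ s (momentumFlip i0 q.1) q.2).2 m - (Φ s q.1 q.2).2 m| ≤ 2 * |q.1.2 i0| * L m q := by
      intro m
      have h := lightCone_pathwise_zero hω hl hβ hγ hN q.1 (η := P.pairNoise N T T (pairPath q.2))
        (P.continuous_pairNoise N T T (pairPath q.2)) hs0 m (t' := s) ⟨hs0, le_rfl⟩
      exact h
    have hLk : L k1 q ≤ L k q := by
      refine (hLsum k1 q).tsum_le_tsum (fun n => ?_) (hLsum k q)
      by_cases h1 : k1.val ≤ n
      · have h2 : k.val ≤ n := by simp [hk1def] at h1; omega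
        rw [if_pos h1, if_pos h2]
      · rw [if_neg h1]
        split_ifs
        · exact mul_nonneg (ha0 n) (hS0 n q)
        · exact le_rfl
    exact farBond_pathwise_abstract (abs_nonneg _) hcj0 (abs_nonneg _) hj (hu k) (hu k1) hLk
  -- measurability
  have hzm : ∀ r, Measurable fun q : PhaseSpace N × WienerPair => Φ r q.1 q.2 := fun r =>
    pinnedChain_measurable_solMap_pairPath hω hl hβ hγ N T T r
  have hΘm' : Measurable fun q : PhaseSpace N × WienerPair => (momentumFlip i0 q.1, q.2) :=
    ((measurable_momentumFlip i0).comp measurable_fst).prodMk measurable_snd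
  have hz'm : ∀ r, Measurable fun q : PhaseSpace N × WienerPair => Φ r (momentumFlip i0 q.1) q.2 := fun r => by
    have h := (hzm r).comp hΘm'
    exact h
  have hEc : Continuous E := by simp only [hE]; fun_prop
  have hH1 : ContDiff ℝ 1 (P.hamiltonian N) := pinnedChain_contDiff_hamiltonian ω₂ lam β γ N
  have hac : Continuous fun x : PhaseSpace N => x.2 i0 * partialQ i0 (P.hamiltonian N) x :=
    (by fun_prop : Continuous fun z : PhaseSpace N => z.2 i0).mul (P.continuous_partialQ_hamiltonian hH1 _)
  have hGm : Measurable G := by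
    have m1 : Measurable fun q : PhaseSpace N × WienerPair => |q.1.2 i0 * partialQ i0 (P.hamiltonian N) q.1| :=
      (hac.measurable.comp measurable_fst).abs
    have m2 : Measurable fun q : PhaseSpace N × WienerPair => 2 * |q.1.2 i0| :=
      ((measurable_pi_apply i0).comp (measurable_snd.comp measurable_fst)).abs.const_mul 2
    have m3 : Measurable fun q : PhaseSpace N × WienerPair => E (Φ s q.1 q.2) ^ 2 :=
      (hEc.measurable.comp (hzm s)).pow_const 2
    have m4 : Measurable fun q : PhaseSpace N × WienerPair => E (Φ s (momentumFlip i0 q.1) q.2) ^ 2 :=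
      (hEc.measurable.comp (hz'm s)).pow_const 2
    exact (((m1.const_mul cj).mul m2).mul m3).mul m4
  have hθm : ∀ m, Measurable (θ m) := fun m => measurable_siteWeight hω hl hβ hγ (T := T) N i0 m s
  have hΘm : ∀ l, Measurable (Θ l) := fun l =>
    Finset.measurable_sum _ fun m _ => by split_ifs <;> [exact hθm m; exact measurable_const]
  have hSm : ∀ n, Measurable (S n) := fun n =>
    Finset.measurable_sum _ fun l _ => by
      split_ifs <;> [exact ((hΘm l).const_mul C₁).pow_const n; exact measurable_const]
  -- second moments of the two factors
  have hGsq : ∫⁻ q, ENNReal.ofReal (G q) ^ 2 ∂π ≤ ENNReal.ofReal KG := by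
    have h := lintegral_prefactor_sq_le hω hl hβ hγ hT hK hN hN2 k hk s
    calc ∫⁻ q, ENNReal.ofReal (G q) ^ 2 ∂π = ∫⁻ q, ENNReal.ofReal (G q ^ 2) ∂π :=
          lintegral_congr fun q => (ENNReal.ofReal_pow (hG0 q) 2).symm
      _ ≤ ENNReal.ofReal KG := h
  have hSsq : ∀ n : ℕ, k.val ≤ n → ∫⁻ q, ENNReal.ofReal (S n q) ^ 2 ∂π ≤ ENNReal.ofReal (M n) := by
    intro n hn
    have h := lintegral_coneSum_sq_le hω hl hβ hγ hT hC1 hA0 hmom hN hs0 hs1 hC₁0 (hk1.trans hn)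
    calc ∫⁻ q, ENNReal.ofReal (S n q) ^ 2 ∂π = ∫⁻ q, ENNReal.ofReal (S n q ^ 2) ∂π :=
          lintegral_congr fun q => (ENNReal.ofReal_pow (hS0 n q) 2).symm
      _ ≤ _ := h
  have hreal : ∀ n : ℕ, k.val ≤ n → 2 * a n * (Real.sqrt KG * Real.sqrt (M n)) ≤
      (2 * ρ) ^ k.val * (2 * Real.sqrt KG * Real.sqrt (15 * C)) * (1 / 2) ^ n := fun n hn =>
    annealedTerm_le hC0 hC₁0 hA₁0 hs0 hρhalf hn
  -- assemble
  have key := lintegral_annealedSeries_le π (k := k.val) hGm hSm hG0 hS0 ha0 hKG0 hM0 (by positivity) hρ0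
    (fun q => hLsum k q) hGsq hSsq hreal
  calc ∫⁻ q, ENNReal.ofReal (|q.1.2 i0 * partialQ i0 (P.hamiltonian N) q.1| *
        |P.bondCurrent N k (Φ s (momentumFlip i0 q.1) q.2) - P.bondCurrent N k (Φ s q.1 q.2)|) ∂π
      ≤ ∫⁻ q, ENNReal.ofReal (G q * (2 * L k q)) ∂π := lintegral_mono fun q => ENNReal.ofReal_le_ofReal (hF1 q)
    _ ≤ ENNReal.ofReal (2 * (2 * Real.sqrt KG * Real.sqrt (15 * C)) * (2 * ρ) ^ k.val) := key
    _ = ENNReal.ofReal (4 * Real.sqrt KG * Real.sqrt (15 * C) * (1440 * Real.exp 1 * C₁ * A₁ * s) ^ k.val) := by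
        congr 1
        rw [show 1440 * Real.exp 1 * C₁ * A₁ * s = 2 * ρ by rw [hρdef]; ring]
        ring

/-- **Registered helper `helper_kdAnnealedFarBond` (stub S, line `kick-dipole-no-collapse`): THE ANNEALED LOCAL LIGHT CONE AT A
FAR BOND** (closed form of `lintegral_contactPower_mul_flipDiff_le` with the constants of helpers 8 and 11 inlined): there are
`B ≥ 0` and a rate `r > 0`, depending only on `(ω₂, lam, β, γ, T)`, such that for every `N ≥ 2`, every genuine bond `(k, k+1)` with
`k ≥ 1` and every `s ∈ [0, 1]` with `r s ≤ 1`:  `∫⁻ |a₀(x)| |j_k(Φ_s x^0) − j_k(Φ_s x)| d(μ_T ⊗ W) ≤ B (r s)^k`. -/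
theorem helper_kdAnnealedFarBond : ∀ ω₂ lam β γ : ℝ, 0 < ω₂ → 0 ≤ lam → 0 ≤ β → 0 ≤ γ → ∀ T : ℝ, 0 < T → ∃ B r : ℝ, 0 ≤ B ∧ 0 < r ∧ ∀ (N : ℕ) (hN : 0 < N), 2 ≤ N → ∀ (k : Fin N), k.val + 1 < N → 1 ≤ k.val → ∀ s : ℝ, 0 ≤ s → s ≤ 1 → r * s ≤ 1 → ∫⁻ q, ENNReal.ofReal (|q.1.2 ⟨0, hN⟩ * partialQ ⟨0, hN⟩ ((pinnedChain ω₂ lam β γ).hamiltonian N) q.1| * |(pinnedChain ω₂ lam β γ).bondCurrent N k ((pinnedChain ω₂ lam β γ).solMap N T T s (momentumFlip ⟨0, hN⟩ q.1) (pairPath q.2)) - (pinnedChain ω₂ lam β γ).bondCurrent N k ((pinnedChain ω₂ lam β γ).solMap N T T s q.1 (pairPath q.2))|) ∂(((pinnedChain ω₂ lam β γ).gibbsMeasure N T).prod wienerPair) ≤ ENNReal.ofReal (B * (r * s) ^ k.val) := by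
  intro ω₂ lam β γ hω hl hβ hγ T hT
  obtain ⟨K, -, hK⟩ := exists_bondScalar_moment_bound hω hl hβ hT
  obtain ⟨C, A, hC1, hA0, hmom⟩ := helper_kdGibbsFactorialMoments ω₂ lam β γ hω hl hβ T hT
  refine ⟨4 * Real.sqrt (4 * (7 + 15 * β) ^ 2 * (ω₂ + 2 * lam + 2 + 5 * β) ^ 2 * K) * Real.sqrt (15 * C),
    1440 * Real.exp 1 * (1 + 2 * γ + (ω₂ + 2 * lam + 8 * (1 + 2 * β))) * max A 1, by positivity, ?_,
    fun N hN hN2 k hk hk1 s hs0 hs1 hsr => ?_⟩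
  · have : 0 < max A 1 := lt_of_lt_of_le one_pos (le_max_right _ _)
    positivity
  · have h := lintegral_contactPower_mul_flipDiff_le hω hl hβ hγ hT hK hC1 hA0 hmom hN hN2 k hk hk1 hs0 hs1
      (by simpa [mul_assoc] using hsr)
    simpa [mul_assoc] using h

end Summit.AtomisticToContinuum.FouriersLaw.Cruxes.ConductanceLowerBound.KickDipoleNoCollapse

end
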